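import Summits.HubbardSuperconductivity.HubbardSuperconductivity.Theses.AnisotropyChord
import Summits.HubbardSuperconductivity.HubbardSuperconductivity.Theorems.AnisotropyChordSectorAnchorXYHalfFilled
import Literature.MathematicalPhysics.QuantumLattice.XYOrderGDProofs
import Literature.MathematicalPhysics.QuantumLattice.XYOrderProofs
import Literature.MathematicalPhysics.QuantumLattice.SpinChainsAkltCorrelationProofs

/-!
# Route `AnisotropyChord`, support `SectorAnchorXY` (stmt-HubbardSuperconductivity-0977) — part 4:
# the Kennedy–Lieb–Shastry anchor in sector form

**Theorem** (`sectorAnchorXY_proof : SectorAnchorXY`). There are `c > 0` and `M₀` such that for every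
even `M ≥ M₀` every normalised `S³_tot = 0` sector ground state `ψ` of the spin-½ ferromagnetic XY
torus `H_M(0) = xxzHamiltonian 1 (torusGraph 2 M) (-1) 0 = xyTorus 2 M 1` has
`Re⟨ψ, S⁺_tot S⁻_tot ψ⟩ ≥ c·M⁴` (the `Δ = 0` instance of `HalfFilledOrder`, shared verbatim with
`PlaquetteBoson.PbXYSectorAnchor`).

Proof (parts 1–3 are `Theorems/AnisotropyChordSectorAnchorXY{SecondOrder,ChemPotRP,HalfFilled}`).
(1) Kennedy–Lieb–Shastry in the tree (`kennedy_lieb_shastry_xy_ground_holds`, `d = 2`, `n = 1`):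
`liminf_k (2k)⁻⁴ Σ_{x,y} Σ_{α=1,2} Re ω₀(S^α_x S^α_y) > 0` for the TRACIAL ground-state functional
`ω₀`; a positive `liminf` of a nonnegative sequence gives a floor `a·M⁴ ≤ Σ_{x,y} …` for all large
even `M` (`kls_planarFloor`). (2) `Σ_{x,y} Σ_α S^α_x S^α_y = (S¹_tot)² + (S²_tot)²` and the `su(2)`
identity `(S¹)² + (S²)² + S³ = S⁺S⁻` of the total spin (`isSu2Triple_on`), so on the sector
`S³_tot = 0` the KLS order parameter is `S⁺_tot S⁻_tot`. (3) Every ground vector of the XY torus is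
half filled (`groundSpace_xyTorus_le_spinZSector_zero`, part 3 = Aizenman–Lieb–Seiringer–Solovej–
Yngvason 2004, App. A) and the half-filled sector ground state is Perron–Frobenius unique
(`SectorGroundStatePerron_proof`), so the ground space is the line of the given `ψ` and
`ω₀ = ⟨ψ, · ψ⟩` (`groundStateFunctional_eq_of_hasUniqueGroundState`).

Sources: T. Kennedy, E. H. Lieb, B. S. Shastry, Phys. Rev. Lett. 61 (1988) 2582, Theorem;
M. Aizenman, E. H. Lieb, R. Seiringer, J. P. Solovej, J. Yngvason, Phys. Rev. A 70 (2004) 023612,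
App. A; H. Tasaki, *Physics and Mathematics of Quantum Many-Body Systems* (2020) §2.1, §2.4.
No definition is introduced.
-/

-- the mandated namespace `Summit.<Summit>.<Problem>.Theorems` repeats `HubbardSuperconductivity`
set_option linter.dupNamespace false

noncomputable section

namespace Summit.HubbardSuperconductivity.HubbardSuperconductivity.Theorems.AnisotropyChord

open Matrix Finset Filter Complex
open Literature.MathematicalPhysics.QuantumLattice Literature.Probability.LatticeModels
open Summit.HubbardSuperconductivity.HubbardSuperconductivity.Theses.AnisotropyChord
open Summit.AtomisticToContinuum.BoseEinsteinCondensation.Theorems (SectorGroundStatePerron_proof)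

/-! ### The planar part of the total spin -/

section Operators

variable {Λ : Type*} [Fintype Λ] [DecidableEq Λ]

/-- **`(S¹_tot)² + (S²_tot)² + S³_tot = S⁺_tot S⁻_tot`** for spin `n/2`: with `S^± = S¹ ± iS²`,
`S⁺S⁻ = (S¹)² + (S²)² - i[S¹, S²]` and `[S⁺, S⁻] = 2S³` (`isSu2Triple_on`). Tasaki (2020) §2.4,
eq. (2.4.7). [folklore] -/
theorem planarSq_add_zOn_eq_raiseOn_mul_lowerOn (n : ℕ) :
    (totalSpin n 0 * totalSpin n 0 + totalSpin n 1 * totalSpin n 1 + zOn n Finset.univ :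
        Op Λ (n + 1)) = raiseOn n Finset.univ * lowerOn n Finset.univ := by
  have hPM := (isSu2Triple_on n (Finset.univ : Finset Λ)).comm_PM
  rw [raiseOn_univ, lowerOn_univ] at hPM ⊢
  set X : Op Λ (n + 1) := totalSpin n 0
  set Y : Op Λ (n + 1) := totalSpin n 1
  set Z : Op Λ (n + 1) := zOn n Finset.univ
  have h1 : (X + I • Y) * (X - I • Y) = X * X + Y * Y - I • (X * Y - Y * X) := by
    simp only [mul_sub, add_mul, smul_mul_assoc, mul_smul_comm, smul_smul,
      I_mul_I, smul_add, smul_sub, neg_smul, one_smul]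
    abel
  have h2 : (X - I • Y) * (X + I • Y) = X * X + Y * Y + I • (X * Y - Y * X) := by
    simp only [mul_add, sub_mul, smul_mul_assoc, mul_smul_comm, smul_smul,
      I_mul_I, smul_sub, neg_smul, one_smul]
    abel
  rw [h1, h2] at hPM
  -- `hPM : -2i[S¹,S²] = 2 S³`
  have h3 : (2 : ℂ) • (-(I • (X * Y - Y * X))) = (2 : ℂ) • Z := by
    rw [← hPM, two_smul]; abel
  have h4 : -(I • (X * Y - Y * X)) = Z := by
    have := congrArg (fun A : Op Λ (n + 1) => (2 : ℂ)⁻¹ • A) h3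
    simpa only [inv_smul_smul₀ (two_ne_zero (α := ℂ))] using this
  rw [h1, ← h4]
  abel

/-- On the sector `S³_tot = 0` the planar Casimir acts as `S⁺_tot S⁻_tot`:
`(S⁺S⁻) ψ = ((S¹)² + (S²)²) ψ`. Tasaki (2020) §2.4. [folklore] -/
theorem raiseOn_mul_lowerOn_mulVec_of_mem_zero (n : ℕ) {ψ : TensorIndex Λ (n + 1) → ℂ}
    (hψ : ψ ∈ spinZSector (Λ := Λ) n 0) :
    (raiseOn n Finset.univ * lowerOn n Finset.univ) *ᵥ ψ =
      (totalSpin n 0 * totalSpin n 0 + totalSpin n 1 * totalSpin n 1) *ᵥ ψ := by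
  have hZ : zOn n Finset.univ *ᵥ ψ = 0 := by
    rw [(mem_spinZSector_iff_mulVec n 0 ψ).1 hψ, ofReal_zero, zero_smul]
  rw [← planarSq_add_zOn_eq_raiseOn_mul_lowerOn, add_mulVec, hZ, add_zero]

end Operators

/-! ### The KLS order parameter as a ground-state expectation -/

/-- `Σ_{x,y} G_L(x,y) = Re ω₀((S¹_tot)² + (S²_tot)²)` for the KLS correlation
`G_L(x,y) = Σ_{α=1,2} Re ω₀(S^α_x S^α_y)` of `XYOrder.lean`. [Kennedy–Lieb–Shastry 1988, the order
parameter] [folklore] -/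
theorem sum_sum_groundStateXYCorrTorus {d : ℕ} (L : ℕ) [NeZero L] (n : ℕ) :
    ∑ x : TorusSite d L, ∑ y : TorusSite d L, groundStateXYCorrTorus (d := d) L n x y =
      ((xyTorus d L n).groundStateFunctional
        (totalSpin n 0 * totalSpin n 0 + totalSpin n 1 * totalSpin n 1)).re := by
  have hα : ∀ α : Fin 3, ∑ x : TorusSite d L, ∑ y : TorusSite d L, xyGroundCorr α L n x y =
      ((xyTorus d L n).groundStateFunctional (totalSpin n α * totalSpin n α)).re := by
    intro α
    rw [totalSpin, sum_mul_sum, map_sum, re_sum]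
    refine sum_congr rfl fun x _ => ?_
    rw [map_sum, re_sum]
    exact sum_congr rfl fun y _ => xyGroundCorr_of_neZero α L n x y
  simp only [groundStateXYCorrTorus_eq_add, sum_add_distrib]
  rw [hα 0, hα 1, map_add, add_re]

/-- The KLS order parameter is nonnegative: `0 ≤ Σ_{x,y} G_L(x,y)` (`Re ω₀(C²) ≥ 0` for Hermitian
`C`). [folklore] -/
theorem sum_sum_groundStateXYCorrTorus_nonneg {d : ℕ} (L : ℕ) [NeZero L] (n : ℕ) :
    0 ≤ ∑ x : TorusSite d L, ∑ y : TorusSite d L, groundStateXYCorrTorus (d := d) L n x y := by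
  rw [sum_sum_groundStateXYCorrTorus, map_add, add_re]
  exact add_nonneg (re_groundStateFunctional_mul_self_nonneg _ (totalSpin_isHermitian n 0))
    (re_groundStateFunctional_mul_self_nonneg _ (totalSpin_isHermitian n 1))

/-- **Kennedy–Lieb–Shastry, floor form** (`d = 2`, spin ½): there are `a > 0` and `M₀` such that
`a·M⁴ ≤ Σ_{x,y} G_M(x,y)` for every even `M ≥ M₀` — a positive `liminf` (the tree's
`kennedy_lieb_shastry_xy_ground_holds`) of a nonnegative sequence is eventually undercut by any
smaller positive number. [Kennedy–Lieb–Shastry 1988, Theorem] [cite: KLS1988PRL, Theorem] -/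
theorem kls_planarFloor :
    ∃ a : ℝ, 0 < a ∧ ∃ M₀ : ℕ, ∀ (M : ℕ) [NeZero M], Even M → M₀ ≤ M →
      a * (M : ℝ) ^ 4 ≤
        ∑ x : TorusSite 2 M, ∑ y : TorusSite 2 M, groundStateXYCorrTorus (d := 2) M 1 x y := by
  have hLRO := kennedy_lieb_shastry_xy_ground_holds 2 le_rfl 1 le_rfl
  unfold HasEvenTorusLRO HasLongRangeOrder at hLRO
  rw [← Filter.liminf_nat_add _ 1] at hLRO
  have key : ∀ k : ℕ,
      (∑ x ∈ halfOpenBox 2 (2 * (k + 1)), ∑ y ∈ halfOpenBox 2 (2 * (k + 1)),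
          torusPullback (fun L x y => groundStateXYCorrTorus (d := 2) L 1 x y) (2 * (k + 1)) x y) /
        ((halfOpenBox 2 (2 * (k + 1))).card : ℝ) ^ 2 =
      (∑ x : TorusSite 2 (2 * k + 1 + 1), ∑ y : TorusSite 2 (2 * k + 1 + 1),
          groundStateXYCorrTorus (d := 2) (2 * k + 1 + 1) 1 x y) /
        (((2 * k + 1 + 1 : ℕ) : ℝ) ^ 2) ^ 2 := by
    intro k
    rw [show 2 * (k + 1) = 2 * k + 1 + 1 by ring, XYOrderProofs.sum_halfOpenBox_torusPullback,
      card_halfOpenBox, Nat.cast_pow]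
  simp only [key] at hLRO
  have hnn : ∀ k : ℕ, 0 ≤ (∑ x : TorusSite 2 (2 * k + 1 + 1), ∑ y : TorusSite 2 (2 * k + 1 + 1),
      groundStateXYCorrTorus (d := 2) (2 * k + 1 + 1) 1 x y) /
        (((2 * k + 1 + 1 : ℕ) : ℝ) ^ 2) ^ 2 :=
    fun k => div_nonneg (sum_sum_groundStateXYCorrTorus_nonneg _ 1) (by positivity)
  obtain ⟨a, ha0, hal⟩ := exists_between hLRO
  have hev := Filter.eventually_lt_of_lt_liminf hal (isBoundedUnder_of ⟨0, hnn⟩)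
  obtain ⟨K₀, hK₀⟩ := Filter.eventually_atTop.1 hev
  refine ⟨a, ha0, 2 * K₀ + 2, fun M _ hMeven hM => ?_⟩
  obtain ⟨j, hj⟩ := hMeven
  obtain ⟨k, rfl⟩ : ∃ k, M = 2 * k + 1 + 1 := ⟨j - 1, by omega⟩
  have hk : K₀ ≤ k := by omega
  have h := hK₀ k hk
  rw [lt_div_iff₀ (by positivity)] at h
  have h4 : (((2 * k + 1 + 1 : ℕ) : ℝ) ^ 2) ^ 2 = ((2 * k + 1 + 1 : ℕ) : ℝ) ^ 4 := by ring
  rw [h4] at h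
  exact h.le

/-! ### The ground state of the half-filled XY torus is unique -/

/-- **The ground space of the spin-½ XY torus is a line in the sector `S³_tot = 0`** (even `M ≥ 4`):
it is spanned by the Perron–Frobenius vector of the half-filled sector
(`SectorGroundStatePerron_proof`), because every ground vector is half filled
(`groundSpace_xyTorus_le_spinZSector_zero`); in particular the sector energy of `S³_tot = 0` is
the ground energy. Aizenman–Lieb–Seiringer–Solovej–Yngvason (2004), App. A; Tasaki (2020) §2.4.
[folklore] -/
theorem xyTorus_groundSpace_eq_span (M : ℕ) [NeZero M] (hM : Even M) (h4 : 4 ≤ M) :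
    ∃ φ : TensorIndex (TorusSite 2 M) 2 → ℂ, φ ≠ 0 ∧ φ ∈ spinZSector (Λ := TorusSite 2 M) 1 0 ∧
      (xyTorus 2 M 1).groundSpace = ℂ ∙ φ ∧
      lowestEnergyInSector 1 (xyTorus 2 M 1) 0 = (xyTorus 2 M 1).groundEnergy := by
  set H : Op (TorusSite 2 M) 2 := xyTorus 2 M 1 with hHdef
  have hH : H.IsHermitian := xyTorus_isHermitian 2 M 1
  haveI : Nonempty (TensorIndex (TorusSite 2 M) 2) := ⟨fun _ => 0⟩
  -- every ground vector is half filled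
  have hGS : H.groundSpace ≤ spinZSector 1 0 :=
    groundSpace_xyTorus_le_spinZSector_zero (d := 2) (by norm_num) M hM (by omega)
  -- the Perron vector of the half-filled sector
  obtain ⟨φ, hφ0, -, hφK, hHφ, huniq⟩ :=
    SectorGroundStatePerron_proof 2 M (by norm_num) (by omega) (M ^ 2 / 2) (Nat.div_le_self _ _)
  have hlabel : ((M ^ 2 / 2 : ℕ) : ℝ) - (M : ℝ) ^ 2 / 2 = 0 := by
    obtain ⟨k, rfl⟩ := hM
    have hk : (k + k) ^ 2 / 2 = 2 * k ^ 2 := by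
      rw [show (k + k) ^ 2 = 2 * (2 * k ^ 2) by ring, Nat.mul_div_cancel_left _ (by norm_num)]
    rw [hk]
    push_cast
    ring
  rw [hlabel] at hφK hHφ huniq
  -- the sector energy is the ground energy
  obtain ⟨u, huG, hu0⟩ := (Submodule.ne_bot_iff _).1 (groundSpace_ne_bot_holds hH)
  have hEsec : lowestEnergyInSector 1 H 0 = H.groundEnergy :=
    lowestEnergyInSector_eq_groundEnergy hH hu0 huG (hGS huG)
  refine ⟨φ, hφ0, hφK, le_antisymm ?_ ?_, hEsec⟩
  · intro v hvG
    have hvK : v ∈ spinZSector (Λ := TorusSite 2 M) 1 0 := hGS hvG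
    have hHv : H *ᵥ v = ((lowestEnergyInSector 1 H 0 : ℝ) : ℂ) • v := by
      rw [hEsec]; exact (mem_groundSpace_iff H v).1 hvG
    obtain ⟨c, hc⟩ := huniq v hvK hHv
    exact Submodule.mem_span_singleton.2 ⟨c, hc.symm⟩
  · rw [Submodule.span_singleton_le_iff_mem, mem_groundSpace_iff, ← hEsec]
    exact hHφ

/-! ### The theorem -/

/-- **`SectorAnchorXY` holds** (route `AnisotropyChord`, item `stmt-HubbardSuperconductivity-0977`;
verbatim `PlaquetteBoson.PbXYSectorAnchor`): the Kennedy–Lieb–Shastry anchor in sector form — for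
even `M ≥ M₀` every normalised `S³_tot = 0` sector ground state `ψ` of `xxzHamiltonian 1
(torusGraph 2 M) (-1) 0` has `Re⟨ψ, S⁺_tot S⁻_tot ψ⟩ ≥ c·M⁴`. KLS floor for the tracial functional
(`kls_planarFloor`), `ω₀ = ⟨ψ, · ψ⟩` by uniqueness (`xyTorus_groundSpace_eq_span`,
`groundStateFunctional_eq_of_hasUniqueGroundState`), and `(S¹)² + (S²)² = S⁺S⁻` on the sector
(`raiseOn_mul_lowerOn_mulVec_of_mem_zero`). [Kennedy–Lieb–Shastry 1988, Theorem;
Aizenman–Lieb–Seiringer–Solovej–Yngvason 2004, App. A] [cite: KLS1988PRL, Theorem] -/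
theorem sectorAnchorXY_proof : SectorAnchorXY := by
  obtain ⟨a, ha, M₀, hfloor⟩ := kls_planarFloor
  refine ⟨a, ha, max M₀ 4, fun M _ hM hMle ψ hψK hψ1 hHψ => ?_⟩
  have h4 : 4 ≤ M := le_of_max_le_right hMle
  have hM₀ : M₀ ≤ M := le_of_max_le_left hMle
  -- `H_M(0)` is the XY torus, definitionally
  change xyTorus 2 M 1 *ᵥ ψ = ((lowestEnergyInSector 1 (xyTorus 2 M 1) 0 : ℝ) : ℂ) • ψ at hHψ
  set H : Op (TorusSite 2 M) 2 := xyTorus 2 M 1 with hHdef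
  obtain ⟨φ, hφ0, -, hspan, hEsec⟩ := xyTorus_groundSpace_eq_span M hM h4
  -- `ψ` spans the ground space
  have hψG : ψ ∈ H.groundSpace := by
    rw [mem_groundSpace_iff, ← hEsec]; exact hHψ
  have hψ0 : ψ ≠ 0 := fun h => by
    rw [h, dotProduct_zero] at hψ1
    exact zero_ne_one hψ1
  have hU : H.HasUniqueGroundState := by
    change Module.finrank ℂ H.groundSpace = 1
    rw [hspan]
    exact finrank_span_singleton hφ0
  have hω : ∀ O : Op (TorusSite 2 M) 2, H.groundStateFunctional O = star ψ ⬝ᵥ O *ᵥ ψ := fun O => by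
    rw [groundStateFunctional_eq_of_hasUniqueGroundState hU hψG hψ0, hψ1, div_one]
  -- the KLS floor, read in the vector state `ψ`
  have hfl := hfloor M hM hM₀
  rw [sum_sum_groundStateXYCorrTorus, hω, ← raiseOn_mul_lowerOn_mulVec_of_mem_zero 1 hψK] at hfl
  exact hfl

end Summit.HubbardSuperconductivity.HubbardSuperconductivity.Theorems.AnisotropyChord
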